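import Mathlib
import Summits.RiemannHypothesis.RiemannHypothesis.Theorems.WeilFarFloorSecondOrderLower
import Summits.RiemannHypothesis.RiemannHypothesis.Theorems.WeilFarFloorCoshQuotientContinuity
import HarnessLib

/-!
# The floor gap is comparable to the residual energy `J·M/(M² + J) ≤ λ_max − R_c`, and the cosh profile is never extremal (RH-free)

Helper file (`--supports stmt-RiemannHypothesis-0098`, lead-track anchor: Weil-positivity window ladder, format-C far bound),
pure proofs.  Seat rh-explicit-weil-1 gen15 (memo `run/shared/lean/pub/rh-explicit/rh-explicit-weil-1/FORMAT-K3.md` §16).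

`C_b = 1_{[−b,b]}cosh(·/2)`, `N = b + sinh b`, `R_c(b) = Q_b(C_b)/N`, `r = 1_{[−b,b]}(T_bC_b − R_cC_b)`, `ρ = ∫r²`, `J = ρ/N`,
`W_b = Σ_{log n<2b} 2Λ(n)/√n`.

* §1 (RH-free) `coshQuotient_add_comparable_le_farCoercivityFloor`: **`R_c(b) + J·M/(M² + J) ≤ λ_max(b)`**, `M = W_b + R_c(b) + 1`
  (`b > 0`): the two-direction Rayleigh bound of `WeilFarFloorSecondOrderLower` at `t = 1/M` with the TRIVIAL bound
  `Q_b(r) ≥ −W_b·ρ` (`abs_primeShiftForm_sub_le` against `0`) — an effective, hypothesis-free lower bound of the gap by the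
  residual energy (`M ≍ 5e^b`, so `≈ J/(5R_c)`; the sharp lower half `(J/R_c)(1 + Q_b(r)/(ρR_c))/(1 + J/R_c²)` of that file needs
  the sign of `R_c + Q_b(r)/ρ`).
* §2 glue: the two residual energies agree, `∫ (1_{[−b,b]}G)² = ∫_{(−b,b)} G²` (`integral_residual_sq_eq_setIntegral`).
* §3 ★ THE COSH PROFILE IS NEVER EXTREMAL: for every window containing a prime shift (`b > (log 2)/2`) and every real `R`,
  `∫ (1_{[−b,b]}(T_bC_b − R·C_b))² > 0` (`integral_residual_sq_pos`: on the left edge `(−b, −b + δ)` the residual is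
  `α·cosh(x/2) + β·sinh(x/2)` with `β = Σ (Λ(n)/√n)sinh(log n/2) > 0`, which vanishes at most once), hence
  **`R_c(b) < λ_max(b)`** (`coshQuotient_lt_farCoercivityFloor`): the cosh test is asymptotically THE extremal (C-XIII″) but never
  an eigenfunction; under RH the defect is `(1 + o(1))J/R_c` (`WeilFarFloorSecondOrderExactRH`).
Standard axioms only; no `RiemannHypothesis` anywhere.  Nothing here bears on the truth of RH.
-/

set_option linter.dupNamespace false
set_option autoImplicit false

noncomputable section

open MeasureTheory Set Filter
open scoped Real Topology ArithmeticFunction.vonMangoldt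

namespace Summit.RiemannHypothesis.RiemannHypothesis.Theorems.WeilFormatC

namespace FloorSecondOrder

open Literature.NumberTheory.LFunctions FloorCosh FloorCoshSplit FloorSmoothing

variable {b : ℝ}

/-! ## §1 The RH-free comparability bound -/

/-- **The trivial lower bound of the form**: `−W_b·∫f² ≤ Q_b(f)` for an admissible `f` on `[−b, b]` (`W_b` the weight sum). -/
theorem neg_weightSum_mul_le_primeShiftForm {f : ℝ → ℝ} {Cf : ℝ} (hf : Measurable f) (hCf : ∀ x, |f x| ≤ Cf)
    (hfs : ∀ x, x ∉ Icc (-b) b → f x = 0) :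
    -((∑ n ∈ weilPrimeIndex b, 2 * ((Λ n : ℝ) / Real.sqrt n)) * ∫ x, f x ^ 2) ≤ primeShiftForm b f := by
  have h := abs_primeShiftForm_sub_le (a := b) hf measurable_const hCf (fun _ ↦ (abs_zero.le : |(0:ℝ)| ≤ 0))
    hfs (fun _ _ ↦ rfl)
  have hQ0 : primeShiftForm b (fun _ ↦ (0 : ℝ)) = 0 := by
    unfold primeShiftForm; simp
  rw [hQ0, sub_zero] at h
  simp only [sub_zero, ne_eq, OfNat.ofNat_ne_zero, not_false_eq_true, zero_pow, integral_zero, Real.sqrt_zero,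
    add_zero] at h
  have hs : Real.sqrt (∫ x, f x ^ 2) * Real.sqrt (∫ x, f x ^ 2) = ∫ x, f x ^ 2 :=
    Real.mul_self_sqrt (integral_nonneg fun x ↦ sq_nonneg _)
  rw [hs] at h
  linarith [(abs_le.1 h).1]

/-- **THE GAP IS AT LEAST `J·M/(M² + J)` (RH-free).**  With `C_b = 1_{[−b,b]}cosh(·/2)`, `N = b + sinh b`, `R_c = Q_b(C_b)/N`,
`r = 1_{[−b,b]}(T_bC_b − R_cC_b)`, `J = ∫r²/N` and `M = W_b + R_c + 1`:  `R_c + J·M/(M² + J) ≤ λ_max(b)` (`b > 0`). -/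
theorem coshQuotient_add_comparable_le_farCoercivityFloor (hb : 0 < b) (r : ℝ → ℝ)
    (hr : r = (Icc (-b) b).indicator (fun x ↦
          (∑ n ∈ weilPrimeIndex b, (Λ n : ℝ) / Real.sqrt n *
            ((Icc (-b) b).indicator (fun y ↦ Real.cosh (y / 2)) (x - Real.log n)
              + (Icc (-b) b).indicator (fun y ↦ Real.cosh (y / 2)) (x + Real.log n)))
          - primeShiftForm b ((Icc (-b) b).indicator (fun y ↦ Real.cosh (y / 2))) / (b + Real.sinh b)
            * (Icc (-b) b).indicator (fun y ↦ Real.cosh (y / 2)) x)) :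
    primeShiftForm b ((Icc (-b) b).indicator (fun y ↦ Real.cosh (y / 2))) / (b + Real.sinh b)
        + ((∫ x, r x ^ 2) / (b + Real.sinh b))
            * ((∑ n ∈ weilPrimeIndex b, 2 * ((Λ n : ℝ) / Real.sqrt n))
                + primeShiftForm b ((Icc (-b) b).indicator (fun y ↦ Real.cosh (y / 2))) / (b + Real.sinh b) + 1)
          / (((∑ n ∈ weilPrimeIndex b, 2 * ((Λ n : ℝ) / Real.sqrt n))
                + primeShiftForm b ((Icc (-b) b).indicator (fun y ↦ Real.cosh (y / 2))) / (b + Real.sinh b) + 1) ^ 2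
              + (∫ x, r x ^ 2) / (b + Real.sinh b))
      ≤ farCoercivityFloor b := by
  set R := primeShiftForm b ((Icc (-b) b).indicator (fun y ↦ Real.cosh (y / 2))) / (b + Real.sinh b) with hR
  set N := b + Real.sinh b with hNdef
  set W := ∑ n ∈ weilPrimeIndex b, 2 * ((Λ n : ℝ) / Real.sqrt n) with hW
  set ρ := ∫ x, r x ^ 2 with hρ
  have hN0 : 0 < N := by have := Real.sinh_pos_iff.2 hb; rw [hNdef]; linarith
  have hρ0 : 0 ≤ ρ := integral_nonneg fun x ↦ sq_nonneg _
  have hW0 : 0 ≤ W := Finset.sum_nonneg fun n _ ↦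
    mul_nonneg (by norm_num) (div_nonneg ArithmeticFunction.vonMangoldt_nonneg (Real.sqrt_nonneg _))
  -- `R ≥ 0` (the cosh test's prime sum grows from `Q_0 = 0`)
  have hR0 : 0 ≤ R := by
    obtain ⟨hQ0, -⟩ := primeShiftForm_coshTest_sub_nonneg_le (a := 0) (a' := b) le_rfl hb.le
    have hz : primeShiftForm 0 ((Icc (-(0 : ℝ)) 0).indicator (fun y ↦ Real.cosh (y / 2))) = 0 := by
      rw [primeShiftForm_coshTest]; simp
    rw [hR]; exact div_nonneg (by linarith only [hQ0, hz]) hN0.le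
  set M := W + R + 1 with hM
  have hM0 : 0 < M := by rw [hM]; linarith only [hW0, hR0]
  -- the trivial bound `Q_b(r) ≥ −Wρ`
  obtain ⟨hrm, hrb, hrs⟩ := residual_admissible (b := b) R
  rw [← hr] at hrm hrb hrs
  have hQr : -(W * ρ) ≤ primeShiftForm b r := neg_weightSum_mul_le_primeShiftForm hrm hrb hrs
  -- the two-direction bound at `t = 1/M`
  have h := coshResidual_rayleighTwo_le_farCoercivityFloor hb r (by rw [hr, hR]) (1 / M)
  rw [← hR, ← hNdef, ← hρ] at h
  have hden : 0 < N + (1 / M) ^ 2 * ρ := by positivity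
  have h1 : R * N + 2 * (1 / M) * ρ + (1 / M) ^ 2 * (-(W * ρ)) ≤ farCoercivityFloor b * (N + (1 / M) ^ 2 * ρ) := by
    have h2 := (div_le_iff₀ hden).1 h
    have h3 : (1 / M) ^ 2 * (-(W * ρ)) ≤ (1 / M) ^ 2 * primeShiftForm b r := mul_le_mul_of_nonneg_left hQr (by positivity)
    linarith only [h2, h3]
  -- algebra: `R·N + 2ρ/M − Wρ/M² ≥ R(N + ρ/M²) + ρ/M` since `W + R ≤ M`
  have hkey : R * (N + (1 / M) ^ 2 * ρ) + ρ / M ≤ farCoercivityFloor b * (N + (1 / M) ^ 2 * ρ) := by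
    have h4 : (W + R) * ((1 / M) ^ 2 * ρ) ≤ M * ((1 / M) ^ 2 * ρ) :=
      mul_le_mul_of_nonneg_right (by rw [hM]; linarith only) (by positivity)
    have e : M * ((1 / M) ^ 2 * ρ) = ρ / M := by field_simp
    rw [e] at h4
    have e2 : 2 * (1 / M) * ρ = 2 * (ρ / M) := by ring
    rw [e2] at h1
    nlinarith only [h1, h4]
  have hgap : ρ / M / (N + (1 / M) ^ 2 * ρ) ≤ farCoercivityFloor b - R := by
    rw [div_le_iff₀ hden]; linarith only [hkey]
  have e : ρ / N * (W + R + 1) / ((W + R + 1) ^ 2 + ρ / N) = ρ / M / (N + (1 / M) ^ 2 * ρ) := by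
    rw [← hM]; field_simp
  rw [e]; linarith only [hgap]

/-! ## §2 Glue: the two residual energies agree -/

/-- The two residual energies agree: `∫ (1_{[−b,b]}F)² = ∫_{(−b,b)} F²` for the residual `F = T_bC_b − R_cC_b`. -/
theorem integral_residual_sq_eq_setIntegral (R : ℝ) :
    ∫ x, ((Icc (-b) b).indicator (fun x ↦
          (∑ n ∈ weilPrimeIndex b, (Λ n : ℝ) / Real.sqrt n *
            ((Icc (-b) b).indicator (fun y ↦ Real.cosh (y / 2)) (x - Real.log n)
              + (Icc (-b) b).indicator (fun y ↦ Real.cosh (y / 2)) (x + Real.log n)))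
          - R * (Icc (-b) b).indicator (fun y ↦ Real.cosh (y / 2)) x) x) ^ 2
      = ∫ x in Ioo (-b) b, ((∑ n ∈ weilPrimeIndex b, (Λ n : ℝ) / Real.sqrt n *
            ((Icc (-b) b).indicator (fun y ↦ Real.cosh (y / 2)) (x - Real.log n)
              + (Icc (-b) b).indicator (fun y ↦ Real.cosh (y / 2)) (x + Real.log n)))
          - R * (Icc (-b) b).indicator (fun y ↦ Real.cosh (y / 2)) x) ^ 2 := by
  set F : ℝ → ℝ := fun x ↦ (∑ n ∈ weilPrimeIndex b, (Λ n : ℝ) / Real.sqrt n *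
      ((Icc (-b) b).indicator (fun y ↦ Real.cosh (y / 2)) (x - Real.log n)
        + (Icc (-b) b).indicator (fun y ↦ Real.cosh (y / 2)) (x + Real.log n)))
    - R * (Icc (-b) b).indicator (fun y ↦ Real.cosh (y / 2)) x with hF
  have e1 : (fun x ↦ ((Icc (-b) b).indicator F x) ^ 2) = (Icc (-b) b).indicator (fun x ↦ F x ^ 2) := by
    funext x; by_cases hx : x ∈ Icc (-b) b
    · simp only [indicator_of_mem hx]
    · simp only [indicator_of_notMem hx]; ring
  show ∫ x, ((Icc (-b) b).indicator F x) ^ 2 = ∫ x in Ioo (-b) b, F x ^ 2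
  rw [e1, integral_indicator measurableSet_Icc, setIntegral_congr_set Ioo_ae_eq_Icc.symm]

/-! ## §3 The cosh profile is never extremal (RH-free) -/

/-- ★ **The residual of the cosh profile is never zero**: for `b > (log 2)/2` (the window sees the prime `2`) and every real `R`,
`∫ (1_{[−b,b]}(T_bC_b − R·C_b))² > 0`.  On the left edge `(−b, −b + δ)` of the window only the shifts `x + log n` are visible, so the
residual equals `α·cosh(x/2) + β·sinh(x/2)` with `β = Σ_{log n<2b} (Λ(n)/√n)·sinh(log n/2) > 0`, a function with at most one zero. -/
theorem integral_residual_sq_pos (hb : Real.log 2 / 2 < b) (R : ℝ) :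
    0 < ∫ x, ((Icc (-b) b).indicator (fun x ↦
          (∑ n ∈ weilPrimeIndex b, (Λ n : ℝ) / Real.sqrt n *
            ((Icc (-b) b).indicator (fun y ↦ Real.cosh (y / 2)) (x - Real.log n)
              + (Icc (-b) b).indicator (fun y ↦ Real.cosh (y / 2)) (x + Real.log n)))
          - R * (Icc (-b) b).indicator (fun y ↦ Real.cosh (y / 2)) x) x) ^ 2 := by
  classical
  have hlog2 : 0 < Real.log 2 := Real.log_pos (by norm_num)
  have hb0 : 0 < b := by linarith only [hb, hlog2]
  obtain ⟨hrm, hrb, hrs⟩ := residual_admissible (b := b) R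
  obtain ⟨hCm, hCb, hCs⟩ := FloorCosh.coshTest_admissible b
  set C : ℝ → ℝ := (Icc (-b) b).indicator (fun y ↦ Real.cosh (y / 2)) with hCdef
  set r : ℝ → ℝ := (Icc (-b) b).indicator (fun x ↦
      (∑ n ∈ weilPrimeIndex b, (Λ n : ℝ) / Real.sqrt n * (C (x - Real.log n) + C (x + Real.log n))) - R * C x) with hrdef
  -- the prime `2` is in the index; the edge width `δ`
  have h2 : 2 ∈ weilPrimeIndex b := mem_weilPrimeIndex.2 (by push_cast; linarith only [hb])
  have hne : (weilPrimeIndex b).Nonempty := ⟨2, h2⟩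
  set δ₀ := (weilPrimeIndex b).inf' hne (fun n ↦ 2 * b - Real.log n) with hδ₀
  have hδ₀0 : 0 < δ₀ := (Finset.lt_inf'_iff hne).2 fun n hn ↦ by have := mem_weilPrimeIndex.1 hn; linarith only [this]
  have hδ₀le : ∀ n ∈ weilPrimeIndex b, δ₀ ≤ 2 * b - Real.log n := fun n hn ↦ Finset.inf'_le _ hn
  set δ := min δ₀ (Real.log 2) with hδ
  have hδ0 : 0 < δ := lt_min hδ₀0 hlog2
  have hδ1 : δ ≤ δ₀ := min_le_left _ _
  have hδ2 : δ ≤ Real.log 2 := min_le_right _ _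
  have hδb : δ < 2 * b := by
    have := hδ₀le 2 h2; push_cast at this; linarith only [this, hδ1, hlog2]
  -- the coefficients `α, β` of the residual on the edge
  set α := (∑ n ∈ weilPrimeIndex b, (Λ n : ℝ) / Real.sqrt n * Real.cosh (Real.log n / 2)) - R with hα
  set β := ∑ n ∈ weilPrimeIndex b, (Λ n : ℝ) / Real.sqrt n * Real.sinh (Real.log n / 2) with hβ
  have hβ0 : 0 < β := by
    have hterm : ∀ n ∈ weilPrimeIndex b, 0 ≤ (Λ n : ℝ) / Real.sqrt n * Real.sinh (Real.log n / 2) := fun n _ ↦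
      mul_nonneg (div_nonneg ArithmeticFunction.vonMangoldt_nonneg (Real.sqrt_nonneg _))
        (Real.sinh_nonneg_iff.2 (by have := Real.log_natCast_nonneg n; positivity))
    have h2pos : 0 < (Λ 2 : ℝ) / Real.sqrt 2 * Real.sinh (Real.log (2 : ℕ) / 2) := by
      have hΛ : 0 < (Λ 2 : ℝ) := ArithmeticFunction.vonMangoldt_pos_iff.2 (Nat.prime_two.isPrimePow)
      have hs : 0 < Real.sinh (Real.log (2 : ℕ) / 2) := Real.sinh_pos_iff.2 (by push_cast; positivity)
      positivity
    rw [hβ]; exact lt_of_lt_of_le h2pos (Finset.single_le_sum hterm h2)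
  set q : ℝ → ℝ := fun x ↦ α * Real.cosh (x / 2) + β * Real.sinh (x / 2) with hq
  have hqc : Continuous q := by
    rw [hq]
    exact ((Real.continuous_cosh.comp (continuous_id.div_const 2)).const_mul α).add
      ((Real.continuous_sinh.comp (continuous_id.div_const 2)).const_mul β)
  -- the residual equals `q` on the edge interval
  have hedge : ∀ x ∈ Ioo (-b) (-b + δ), r x = q x := by
    intro x hx
    have hxI : x ∈ Icc (-b) b := ⟨hx.1.le, by linarith only [hx.2, hδb]⟩
    have hCx : C x = Real.cosh (x / 2) := indicator_of_mem hxI _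
    have hterm : ∀ n ∈ weilPrimeIndex b,
        (Λ n : ℝ) / Real.sqrt n * (C (x - Real.log n) + C (x + Real.log n))
          = (Λ n : ℝ) / Real.sqrt n * Real.cosh (Real.log n / 2) * Real.cosh (x / 2)
            + (Λ n : ℝ) / Real.sqrt n * Real.sinh (Real.log n / 2) * Real.sinh (x / 2) := by
      intro n hn
      by_cases hΛ : (Λ n : ℝ) = 0
      · simp only [hΛ, zero_div, zero_mul, add_zero]
      · have hpp : IsPrimePow n := ArithmeticFunction.vonMangoldt_ne_zero_iff.1 hΛ
        have hn2 : (2 : ℝ) ≤ n := by exact_mod_cast hpp.two_le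
        have hlogn : Real.log 2 ≤ Real.log n := Real.log_le_log (by norm_num) hn2
        have hplus : C (x + Real.log n) = Real.cosh ((x + Real.log n) / 2) :=
          indicator_of_mem (show x + Real.log n ∈ Icc (-b) b from
            ⟨by linarith only [hx.1, hlogn, hlog2], by linarith only [hx.2, hδ1, hδ₀le n hn]⟩) _
        have hminus : C (x - Real.log n) = 0 :=
          indicator_of_notMem (fun h ↦ by linarith only [h.1, hx.2, hδ2, hlogn]) _
        rw [hplus, hminus, zero_add, show (x + Real.log n) / 2 = x / 2 + Real.log n / 2 by ring, Real.cosh_add]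
        ring
    show r x = q x
    rw [hrdef, indicator_of_mem hxI, Finset.sum_congr rfl hterm, Finset.sum_add_distrib, ← Finset.sum_mul, ← Finset.sum_mul,
      hCx, hq]
    simp only [hα]; ring
  -- `q` does not vanish identically on the edge: two zeros would force `β·sinh((x₂ − x₁)/2) = 0`
  obtain ⟨x₀, hx₀, hq0⟩ : ∃ x₀ ∈ Ioo (-b) (-b + δ), q x₀ ≠ 0 := by
    by_contra hcon
    push Not at hcon
    have h1 := hcon (-b + δ / 3) ⟨by linarith only [hδ0], by linarith only [hδ0]⟩
    have h3 := hcon (-b + 2 * δ / 3) ⟨by linarith only [hδ0], by linarith only [hδ0]⟩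
    simp only [hq] at h1 h3
    have hkey : β * Real.sinh ((-b + 2 * δ / 3) / 2 - (-b + δ / 3) / 2) = 0 := by
      rw [Real.sinh_sub]
      linear_combination (Real.cosh ((-b + δ / 3) / 2)) * h3 - (Real.cosh ((-b + 2 * δ / 3) / 2)) * h1
    rcases mul_eq_zero.1 hkey with h | h
    · exact absurd h hβ0.ne'
    · rw [Real.sinh_eq_zero] at h
      linarith only [h, hδ0]
  -- a neighbourhood of `x₀` inside the edge on which `q ≠ 0`
  have hev : ∀ᶠ x in 𝓝 x₀, q x ≠ 0 ∧ x ∈ Ioo (-b) (-b + δ) :=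
    (hqc.continuousAt.eventually_ne hq0).and (Ioo_mem_nhds hx₀.1 hx₀.2)
  obtain ⟨ε, hε0, hε⟩ := Metric.eventually_nhds_iff.1 hev
  set u := x₀ - ε / 2 with hu
  set w := x₀ + ε / 2 with hw
  have huw : u < w := by rw [hu, hw]; linarith only [hε0]
  have hball : ∀ x ∈ Icc u w, q x ≠ 0 ∧ x ∈ Ioo (-b) (-b + δ) := fun x hx ↦
    hε (by rw [Real.dist_eq, abs_lt]; constructor <;> linarith only [hx.1, hx.2, hε0, hu, hw])
  -- `0 < ∫_u^w q² = ∫_u^w r² ≤ ∫ r²`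
  have hpos : 0 < ∫ x in u..w, q x ^ 2 :=
    intervalIntegral.intervalIntegral_pos_of_pos_on ((hqc.pow 2).intervalIntegrable _ _)
      (fun x hx ↦ by
        have h := (hball x (Ioo_subset_Icc_self hx)).1
        positivity) huw
  have hrq : ∫ x in u..w, r x ^ 2 = ∫ x in u..w, q x ^ 2 :=
    intervalIntegral.integral_congr fun x hx ↦ by
      rw [uIcc_of_le huw.le] at hx
      simp only [hedge x (hball x hx).2]
  have hri : Integrable fun x ↦ r x ^ 2 := integrable_sq_admissible hrm hrb hrs
  have hle : ∫ x in u..w, r x ^ 2 ≤ ∫ x, r x ^ 2 := by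
    rw [intervalIntegral.integral_of_le huw.le]
    exact setIntegral_le_integral hri (Eventually.of_forall fun x ↦ sq_nonneg _)
  show 0 < ∫ x, r x ^ 2
  linarith only [hpos, hrq, hle]

/-- ★ **THE COSH PROFILE IS NEVER EXTREMAL (RH-free).**  For every window that sees a prime shift, `b > (log 2)/2`:
**`R_c(b) < λ_max(b)`** — the cosh test `C_b = 1_{[−b,b]}cosh(·/2)` is asymptotically the extremal (`λ_max − R_c → 0` under RH,
C-XIII″) but never an eigenfunction of the prime-shift form; the defect is at least `J·M/(M² + J) > 0` (§1) and, under RH,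
`(1 + o(1))·J/R_c` (`WeilFarFloorSecondOrderExactRH`). -/
theorem coshQuotient_lt_farCoercivityFloor (hb : Real.log 2 / 2 < b) :
    primeShiftForm b ((Icc (-b) b).indicator (fun y ↦ Real.cosh (y / 2))) / (b + Real.sinh b) < farCoercivityFloor b := by
  have hlog2 : 0 < Real.log 2 := Real.log_pos (by norm_num)
  have hb0 : 0 < b := by linarith only [hb, hlog2]
  have h := coshQuotient_add_comparable_le_farCoercivityFloor hb0 _ rfl
  set R := primeShiftForm b ((Icc (-b) b).indicator (fun y ↦ Real.cosh (y / 2))) / (b + Real.sinh b) with hR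
  set N := b + Real.sinh b with hNdef
  set W := ∑ n ∈ weilPrimeIndex b, 2 * ((Λ n : ℝ) / Real.sqrt n) with hW
  have hN0 : 0 < N := by have := Real.sinh_pos_iff.2 hb0; rw [hNdef]; linarith only [this, hb0]
  have hW0 : 0 ≤ W := Finset.sum_nonneg fun n _ ↦
    mul_nonneg (by norm_num) (div_nonneg ArithmeticFunction.vonMangoldt_nonneg (Real.sqrt_nonneg _))
  have hR0 : 0 ≤ R := by
    obtain ⟨hQ0, -⟩ := primeShiftForm_coshTest_sub_nonneg_le (a := 0) (a' := b) le_rfl hb0.le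
    have hz : primeShiftForm 0 ((Icc (-(0 : ℝ)) 0).indicator (fun y ↦ Real.cosh (y / 2))) = 0 := by
      rw [primeShiftForm_coshTest]; simp
    rw [hR]; exact div_nonneg (by linarith only [hQ0, hz]) hN0.le
  have hJ : 0 < (∫ x, ((Icc (-b) b).indicator (fun x ↦
      (∑ n ∈ weilPrimeIndex b, (Λ n : ℝ) / Real.sqrt n *
        ((Icc (-b) b).indicator (fun y ↦ Real.cosh (y / 2)) (x - Real.log n)
          + (Icc (-b) b).indicator (fun y ↦ Real.cosh (y / 2)) (x + Real.log n)))
      - R * (Icc (-b) b).indicator (fun y ↦ Real.cosh (y / 2)) x) x) ^ 2) / N :=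
    div_pos (integral_residual_sq_pos hb R) hN0
  have hM : 0 < W + R + 1 := by linarith only [hW0, hR0]
  have hterm : 0 < (∫ x, ((Icc (-b) b).indicator (fun x ↦
      (∑ n ∈ weilPrimeIndex b, (Λ n : ℝ) / Real.sqrt n *
        ((Icc (-b) b).indicator (fun y ↦ Real.cosh (y / 2)) (x - Real.log n)
          + (Icc (-b) b).indicator (fun y ↦ Real.cosh (y / 2)) (x + Real.log n)))
      - R * (Icc (-b) b).indicator (fun y ↦ Real.cosh (y / 2)) x) x) ^ 2) / N * (W + R + 1)
        / ((W + R + 1) ^ 2 + (∫ x, ((Icc (-b) b).indicator (fun x ↦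
      (∑ n ∈ weilPrimeIndex b, (Λ n : ℝ) / Real.sqrt n *
        ((Icc (-b) b).indicator (fun y ↦ Real.cosh (y / 2)) (x - Real.log n)
          + (Icc (-b) b).indicator (fun y ↦ Real.cosh (y / 2)) (x + Real.log n)))
      - R * (Icc (-b) b).indicator (fun y ↦ Real.cosh (y / 2)) x) x) ^ 2) / N) := by
    positivity
  linarith only [h, hterm]

end FloorSecondOrder

end Summit.RiemannHypothesis.RiemannHypothesis.Theorems.WeilFormatC
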